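import Literature.Probability.NegativeDependence.NegativeAssociationMonotoneImages
import Mathlib.Analysis.SpecialFunctions.Exp
import HarnessLib

/-!
# Product inequalities for negatively associated 0/1 variables (Dubhashi–Ranjan §2.1: Lemma 2, Props. 3–5)

D. Dubhashi, D. Ranjan, *Balls and bins: a study in negative dependence*, Random Struct. Algorithms 13 (1998)
99–124 (held `paper:doi-10-1002-sici-1098-2418-199809-13-2-99-aid-rsa1-3-0-co-2-m`), §2.1 (pp. 4–5),
verbatim:

> **Lemma 2** Let `X_1, …, X_n` satisfy the negative association condition (−A). Then for any non-decreasing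
> functions `f_i`, `i ∈ [n]`, `E[∏_{i ∈ [n]} f_i(X_i)] ≤ ∏_{i ∈ [n]} E[f_i(X_i)]`.
> *Proof.* Take the non-decreasing functions `f(X_i, i < n) := ∏_{i<n} f_i(x_i)` and `g(x_n) := f_n(x_n)` to
> deduce that `E[∏_{i∈[n]} f_i(X_i)] ≤ E[∏_{i<n} f_i(X_i)] E[f_n(X_n)]` and now use induction.
>
> **Proposition 3** The negative association property (−A) on a set of variables `X_1, …, X_n` implies the
> following notions of negative dependence: (−COV) Negative Covariance: for any `I ⊆ [n]`,
> `E[∏_{i∈I} X_i] ≤ ∏_{i∈I} E[X_i]`. (−OD) Negative Right Orthant Dependence: For any two disjoint subsets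
> `I, J ⊆ [n]`, `Pr[X_i ≥ t_i, i ∈ I | X_j ≥ t_j, j ∈ J] ≤ Pr[X_i ≥ t_i, i ∈ I]`.
>
> **Proposition 4** (Marginal Probability Bounds) Let `X_1, …, X_n` satisfy (−A). Then
> `Pr[X_i ≥ t_i, i ∈ [n]] ≤ ∏_{i ∈ [n]} Pr[X_i ≥ t_i]`.
>
> **Proposition 5** (−A and Chernoff–Hoeffding Bounds) […] for `t > 0`,
> `E[e^{tX}] = E[∏_i e^{tX_i}] ≤ ∏_i E[e^{tX_i}]`, by Lemma 2 applied with each `f_i(x) := e^{tx}`. […] For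
> the lower tail, we apply the same argument to the variables `b_i - X_i` […] if the `X_i` variables are
> negatively associated, then so are the variables `b_i - X_i`.

## Formalization (0/1-valued variables `X_i = 𝟏[i ∈ S]`, unnormalized nonnegative weights `μ` on `2^σ`)

For an unnormalized weight the printed inequalities carry the factor `μ(Ω)^{|I|-1}` on the left (divide by
`μ(Ω)^{|I|}` to recover them; for `mass μ = 1` they are verbatim). As in the induction of the printed proof the
`f_i` are taken nonnegative (needed for `∏_{i<n} f_i` to be non-decreasing).

* §1 Lemma 2: `IsNegAssoc.ex_prod_mul_pow_le` (non-decreasing `f_i ≥ 0`), and the non-increasing version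
  `IsNegAssoc.ex_prod_mul_pow_le_of_antitone` (via the flipped family `1 - X`, tree: `IsNegAssoc.flip`).
* §2 Prop. 3 (−COV) = Prop. 4 for 0/1 variables: `IsNegAssoc.supset_mul_pow_le`
  (`μ(I ⊆ S)·μ(Ω)^{|I|-1} ≤ ∏_{i∈I} μ(i ∈ S)`); Prop. 3 (−OD): `IsNegAssoc.supset_union_mul_mass_le`.
* §3 Prop. 5 (the Chernoff–Hoeffding step): `IsNegAssoc.ex_exp_card_mul_pow_le`
  (`E[e^{t|S ∩ I|}]·μ(Ω)^{|I|-1} ≤ ∏_{i∈I} E[e^{t X_i}]`, all real `t`: `t ≥ 0` by the non-decreasing and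
  `t ≤ 0` by the non-increasing Lemma 2).
* §4 block sums over pairwise disjoint blocks `I_j`: the threshold events `blockSumGe I j t = {Σ_{I_j} X ≥ t}`,
  **`IsNegAssoc.blockSumGe`** (their indicator vector is NA — Prop. 7 (2) with `h_j = 𝟏[Σ x ≥ t_j]`, via the
  tree's `IsNegAssoc.eventImage`) and **`IsNegAssoc.blockSum_orthant`** ((−OD) for block sums, cf. §3.1
  Remark 15).

## References

* [DubhashiRanjan1998] D. Dubhashi, D. Ranjan, Balls and bins: a study in negative dependence, Random Struct.
  Algorithms 13 (1998) — §2.1 Lemma 2, Prop. 3, Prop. 4, Prop. 5.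
* [JoagDevProschan1983] K. Joag-Dev, F. Proschan, Negative association of random variables with applications,
  Ann. Statist. 11 (1983) — Property P2 (cf. [DR, ref. 13]).
-/

noncomputable section

open Finset
open Literature.Combinatorics.Sahi2008

universe u

namespace Literature.Probability.NegativeDependence

variable {σ : Type u} [Fintype σ] [DecidableEq σ]

/-! ## §0 One-coordinate functions -/

section OneCoordinate

omit [Fintype σ] in
/-- `S ∩ {i} = T ∩ {i}` means `X_i(S) = X_i(T)`. [cite: DubhashiRanjan1998, §2.1 Def. 1] -/
theorem mem_iff_of_inter_singleton_eq {S T : Finset σ} {i : σ} (h : S ∩ {i} = T ∩ {i}) : i ∈ S ↔ i ∈ T := by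
  constructor
  · intro hi
    have : i ∈ T ∩ {i} := h ▸ Finset.mem_inter.2 ⟨hi, Finset.mem_singleton_self i⟩
    exact (Finset.mem_inter.1 this).1
  · intro hi
    have : i ∈ S ∩ {i} := h.symm ▸ Finset.mem_inter.2 ⟨hi, Finset.mem_singleton_self i⟩
    exact (Finset.mem_inter.1 this).1

omit [Fintype σ] in
/-- A function of `X_i` alone, `S ↦ φ(𝟏[i ∈ S])`, depends on `{i}`. [cite: DubhashiRanjan1998, §2.1 Lemma 2
("functions `f_i(X_i)`")] -/
theorem determinedBy_singleton_of_mem (i : σ) (a b : ℝ) :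
    DeterminedBy (fun S : Finset σ => if i ∈ S then a else b) {i} := fun S T hST => by
  simp only [mem_iff_of_inter_singleton_eq hST]

omit [Fintype σ] in
/-- `S ↦ φ(𝟏[i ∈ S])` is non-decreasing when `φ(0) ≤ φ(1)`. [cite: DubhashiRanjan1998, §2.1 Lemma 2] -/
theorem monotone_of_mem (i : σ) {a b : ℝ} (hba : b ≤ a) :
    Monotone (fun S : Finset σ => if i ∈ S then a else b) := fun S T hST => by
  dsimp only
  by_cases hS : i ∈ S
  · rw [if_pos hS, if_pos (hST hS)]
  · rw [if_neg hS]; split_ifs <;> simp [hba]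

omit [Fintype σ] in
/-- `S ↦ φ(𝟏[i ∈ S])` is non-increasing when `φ(1) ≤ φ(0)`. [cite: DubhashiRanjan1998, §2.1 Prop. 5 (lower
tail)] -/
theorem antitone_of_mem (i : σ) {a b : ℝ} (hab : a ≤ b) :
    Antitone (fun S : Finset σ => if i ∈ S then a else b) := fun S T hST => by
  dsimp only
  by_cases hS : i ∈ S
  · rw [if_pos hS, if_pos (hST hS)]
  · rw [if_neg hS]; split_ifs <;> simp [hab]

end OneCoordinate

/-! ## §1 Lemma 2: `E[∏ f_i(X_i)] ≤ ∏ E[f_i(X_i)]` -/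

section Lemma2

/-- **Dubhashi–Ranjan, Lemma 2** (non-decreasing, nonnegative `f_i`, each a function of `X_i` alone; unnormalized
form): `E_μ[∏_{i∈I} f_i] · μ(Ω)^{|I|-1} ≤ ∏_{i∈I} E_μ[f_i]`. The printed induction: split off one factor and
apply NA to `∏_{i<n} f_i` and `f_n`. [cite: DubhashiRanjan1998, §2.1 Lemma 2; JoagDevProschan1983,
Property P2] -/
theorem IsNegAssoc.ex_prod_mul_pow_le {μ : Finset σ → ℝ} (hμ : IsNegAssoc μ) (h0 : ∀ S, 0 ≤ μ S)
    {f : σ → Finset σ → ℝ} (hmono : ∀ i, Monotone (f i)) (hnn : ∀ i S, 0 ≤ f i S)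
    (hdet : ∀ i, DeterminedBy (f i) {i}) {I : Finset σ} (hI : I.Nonempty) :
    ex μ (fun S => ∏ i ∈ I, f i S) * mass μ ^ (I.card - 1) ≤ ∏ i ∈ I, ex μ (f i) := by
  have hmass : 0 ≤ mass μ := by rw [mass_def]; exact Finset.sum_nonneg fun S _ => h0 S
  induction hI using Finset.Nonempty.cons_induction with
  | singleton a =>
    simp only [Finset.prod_singleton, Finset.card_singleton, Nat.sub_self, pow_zero, mul_one]
    exact le_rfl
  | cons a s ha hs IH =>
    rw [Finset.prod_cons, Finset.card_cons, Nat.add_sub_cancel]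
    simp only [Finset.prod_cons]
    -- the product over `s` is non-decreasing, nonnegative and depends on `s`
    have hGmono : Monotone fun S : Finset σ => ∏ i ∈ s, f i S := fun S T hST =>
      Finset.prod_le_prod (fun i _ => hnn i S) fun i _ => hmono i hST
    have hGdet : DeterminedBy (fun S : Finset σ => ∏ i ∈ s, f i S) s := fun S T hST =>
      Finset.prod_congr rfl fun i hi => hdet i S T (by
        rw [← Finset.inter_eq_right.2 (Finset.singleton_subset_iff.2 hi), ← Finset.inter_assoc,
          ← Finset.inter_assoc, hST])
    have hNA := hμ (F := f a) (G := fun S => ∏ i ∈ s, f i S) (hmono a) hGmono (hdet a) hGdet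
      (Finset.disjoint_singleton_left.2 ha)
    have hFnn : 0 ≤ ex μ (f a) := ex_nonneg h0 (hnn a)
    have hcard : s.card = (s.card - 1) + 1 := (Nat.sub_add_cancel hs.card_pos).symm
    calc ex μ (fun S => f a S * ∏ i ∈ s, f i S) * mass μ ^ s.card
        = ex μ ((f a) * fun S => ∏ i ∈ s, f i S) * mass μ * mass μ ^ (s.card - 1) := by
          rw [hcard, pow_succ, Nat.add_sub_cancel]; simp only [Pi.mul_def]; ring
      _ ≤ ex μ (f a) * ex μ (fun S => ∏ i ∈ s, f i S) * mass μ ^ (s.card - 1) :=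
          mul_le_mul_of_nonneg_right hNA (pow_nonneg hmass _)
      _ = ex μ (f a) * (ex μ (fun S => ∏ i ∈ s, f i S) * mass μ ^ (s.card - 1)) := by ring
      _ ≤ ex μ (f a) * ∏ i ∈ s, ex μ (f i) := mul_le_mul_of_nonneg_left IH hFnn

/-- **Lemma 2, non-increasing version** (all `f_i ≥ 0` non-increasing; "if the `X_i` variables are negatively
associated, then so are the variables `b_i - X_i`"): via the flipped family. [cite: DubhashiRanjan1998, §2.1
Lemma 2, Prop. 5 (proof, lower tail)] -/
theorem IsNegAssoc.ex_prod_mul_pow_le_of_antitone {μ : Finset σ → ℝ} (hμ : IsNegAssoc μ) (h0 : ∀ S, 0 ≤ μ S)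
    {f : σ → Finset σ → ℝ} (hanti : ∀ i, Antitone (f i)) (hnn : ∀ i S, 0 ≤ f i S)
    (hdet : ∀ i, DeterminedBy (f i) {i}) {I : Finset σ} (hI : I.Nonempty) :
    ex μ (fun S => ∏ i ∈ I, f i S) * mass μ ^ (I.card - 1) ≤ ∏ i ∈ I, ex μ (f i) := by
  have key := hμ.flip.ex_prod_mul_pow_le (f := fun i S => f i Sᶜ) (fun S => h0 Sᶜ)
    (fun i S T hST => hanti i (Finset.compl_subset_compl.2 hST)) (fun i S => hnn i Sᶜ)
    (fun i => (hdet i).comp_compl) hI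
  rw [ex_flipWeight, mass_flipWeight] at key
  simp only [compl_compl, ex_flipWeight] at key
  exact key

/-- Lemma 2 for a probability weight (`μ(Ω) = 1`), verbatim. [cite: DubhashiRanjan1998, §2.1 Lemma 2] -/
theorem IsNegAssoc.ex_prod_le {μ : Finset σ → ℝ} (hμ : IsNegAssoc μ) (h0 : ∀ S, 0 ≤ μ S) (h1 : mass μ = 1)
    {f : σ → Finset σ → ℝ} (hmono : ∀ i, Monotone (f i)) (hnn : ∀ i S, 0 ≤ f i S)
    (hdet : ∀ i, DeterminedBy (f i) {i}) (I : Finset σ) :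
    ex μ (fun S => ∏ i ∈ I, f i S) ≤ ∏ i ∈ I, ex μ (f i) := by
  rcases I.eq_empty_or_nonempty with hI | hI
  · rw [hI, Finset.prod_empty]
    simp only [Finset.prod_empty]
    have hone : ex μ (fun _ => (1 : ℝ)) = mass μ := by
      rw [ex_def, mass_def]
      exact Finset.sum_congr rfl fun S _ => mul_one _
    rw [hone, h1]
  · have key := hμ.ex_prod_mul_pow_le h0 hmono hnn hdet hI
    rwa [h1, one_pow, mul_one] at key

/-- **Dubhashi–Ranjan, Lemma 2, as printed** (probability weight). [cite: DubhashiRanjan1998, §2.1 Lemma 2] -/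
theorem DubhashiRanjan_lemma_2 {μ : Finset σ → ℝ} (hμ : IsNegAssoc μ) (h0 : ∀ S, 0 ≤ μ S) (h1 : mass μ = 1)
    {f : σ → Finset σ → ℝ} (hmono : ∀ i, Monotone (f i)) (hnn : ∀ i S, 0 ≤ f i S)
    (hdet : ∀ i, DeterminedBy (f i) {i}) (I : Finset σ) :
    ex μ (fun S => ∏ i ∈ I, f i S) ≤ ∏ i ∈ I, ex μ (f i) :=
  hμ.ex_prod_le h0 h1 hmono hnn hdet I

end Lemma2

/-! ## §2 Proposition 3 / Proposition 4: negative covariance and orthant bounds -/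

section Prop34

omit [Fintype σ] in
/-- `∏_{i∈I} 𝟏[i ∈ S] = 𝟏[I ⊆ S]`. [cite: DubhashiRanjan1998, §2.1 Prop. 3 (proof: "`f_i` the identity")] -/
theorem prod_mem_indicator (I S : Finset σ) :
    ∏ i ∈ I, (if i ∈ S then (1 : ℝ) else 0) = if I ⊆ S then 1 else 0 := by
  by_cases h : I ⊆ S
  · rw [if_pos h]
    exact Finset.prod_eq_one fun i hi => if_pos (h hi)
  · rw [if_neg h]
    obtain ⟨i, hiI, hiS⟩ := Finset.not_subset.1 h
    exact Finset.prod_eq_zero hiI (if_neg hiS)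

/-- **Dubhashi–Ranjan, Proposition 3 (−COV) = Proposition 4 for 0/1 variables** (unnormalized):
`μ(I ⊆ S) · μ(Ω)^{|I|-1} ≤ ∏_{i∈I} μ(i ∈ S)`, i.e. `E[∏_{i∈I} X_i] ≤ ∏ E[X_i]` /
`Pr[X_i ≥ 1, i ∈ I] ≤ ∏ Pr[X_i ≥ 1]`. [cite: DubhashiRanjan1998, §2.1 Prop. 3 (−COV), Prop. 4] -/
theorem IsNegAssoc.supset_mul_pow_le {μ : Finset σ → ℝ} (hμ : IsNegAssoc μ) (h0 : ∀ S, 0 ≤ μ S) {I : Finset σ}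
    (hI : I.Nonempty) :
    ex μ (fun S => if I ⊆ S then 1 else 0) * mass μ ^ (I.card - 1) ≤
      ∏ i ∈ I, ex μ (fun S => if i ∈ S then 1 else 0) := by
  have key := hμ.ex_prod_mul_pow_le h0 (f := fun i S => if i ∈ S then (1 : ℝ) else 0)
    (fun i => monotone_of_mem i zero_le_one) (fun i S => by split_ifs <;> norm_num)
    (fun i => determinedBy_singleton_of_mem i 1 0) hI
  simp only [prod_mem_indicator] at key
  exact key

/-- Proposition 4 for a probability weight, verbatim (0/1 variables: `t_i = 1`).
[cite: DubhashiRanjan1998, §2.1 Prop. 4] -/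
theorem DubhashiRanjan_prop_4 {μ : Finset σ → ℝ} (hμ : IsNegAssoc μ) (h0 : ∀ S, 0 ≤ μ S) (h1 : mass μ = 1)
    (I : Finset σ) :
    ex μ (fun S => if I ⊆ S then 1 else 0) ≤ ∏ i ∈ I, ex μ (fun S => if i ∈ S then 1 else 0) := by
  have key := hμ.ex_prod_le h0 h1 (f := fun i S => if i ∈ S then (1 : ℝ) else 0)
    (fun i => monotone_of_mem i zero_le_one) (fun i S => by split_ifs <;> norm_num)
    (fun i => determinedBy_singleton_of_mem i 1 0) I
  simp only [prod_mem_indicator] at key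
  exact key

/-- **Dubhashi–Ranjan, Proposition 3 (−OD), 0/1 variables** (unnormalized): for disjoint `I, J`,
`μ(I ∪ J ⊆ S) · μ(Ω) ≤ μ(I ⊆ S) · μ(J ⊆ S)`, i.e. `Pr[X_i ≥ 1, i ∈ I | X_j ≥ 1, j ∈ J] ≤ Pr[X_i ≥ 1, i ∈ I]`.
[cite: DubhashiRanjan1998, §2.1 Prop. 3 (−OD)] -/
theorem IsNegAssoc.supset_union_mul_mass_le {μ : Finset σ → ℝ} (hμ : IsNegAssoc μ) {I J : Finset σ}
    (hIJ : Disjoint I J) :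
    ex μ (fun S => if I ∪ J ⊆ S then 1 else 0) * mass μ ≤
      ex μ (fun S => if I ⊆ S then 1 else 0) * ex μ (fun S => if J ⊆ S then 1 else 0) := by
  have key := hμ (monotone_subset_indicator I) (monotone_subset_indicator J) (determinedBy_subset_indicator I)
    (determinedBy_subset_indicator J) hIJ
  have hfg : ((fun V : Finset σ => if I ⊆ V then (1 : ℝ) else 0) * fun V : Finset σ => if J ⊆ V then (1 : ℝ)
      else 0) = fun S => if I ∪ J ⊆ S then 1 else 0 := by
    funext S
    simp only [Pi.mul_apply, Finset.union_subset_iff]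
    by_cases hI : I ⊆ S <;> by_cases hJ : J ⊆ S <;> simp [hI, hJ]
  rw [hfg] at key
  exact key

end Prop34

/-! ## §3 Proposition 5: the Chernoff–Hoeffding step `E[e^{tX}] ≤ ∏ E[e^{tX_i}]` -/

section Prop5

omit [Fintype σ] in
/-- `∏_{i∈I} e^{t X_i(S)} = e^{t |S ∩ I|}`. [cite: DubhashiRanjan1998, §2.1 Prop. 5 (proof:
`E[e^{tX}] = E[∏_i e^{tX_i}]`)] -/
theorem prod_exp_mem_indicator (t : ℝ) (I S : Finset σ) :
    ∏ i ∈ I, Real.exp (t * if i ∈ S then (1 : ℝ) else 0) = Real.exp (t * ((S ∩ I).card : ℝ)) := by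
  rw [← Real.exp_sum, ← Finset.mul_sum]
  congr 2
  rw [Finset.sum_boole, Finset.filter_mem_eq_inter, Finset.inter_comm]

omit [Fintype σ] in
/-- `e^{t X_i}` as a one-coordinate function. [cite: DubhashiRanjan1998, §2.1 Prop. 5 (proof)] -/
theorem exp_mul_mem_indicator_eq (t : ℝ) (i : σ) (S : Finset σ) :
    Real.exp (t * if i ∈ S then (1 : ℝ) else 0) = if i ∈ S then Real.exp t else 1 := by
  split_ifs <;> simp

/-- **Dubhashi–Ranjan, Proposition 5 (the Chernoff–Hoeffding step), 0/1 variables, all real `t`**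
(unnormalized): for `X = Σ_{i∈I} X_i = |S ∩ I|`, `E_μ[e^{tX}] · μ(Ω)^{|I|-1} ≤ ∏_{i∈I} E_μ[e^{tX_i}]` — for
`t ≥ 0` by Lemma 2 with the non-decreasing `f_i = e^{tX_i}`, for `t ≤ 0` by its non-increasing version (the
printed "lower tail" via `b_i - X_i`). [cite: DubhashiRanjan1998, §2.1 Prop. 5] -/
theorem IsNegAssoc.ex_exp_card_mul_pow_le {μ : Finset σ → ℝ} (hμ : IsNegAssoc μ) (h0 : ∀ S, 0 ≤ μ S)
    (t : ℝ) {I : Finset σ} (hI : I.Nonempty) :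
    ex μ (fun S => Real.exp (t * ((S ∩ I).card : ℝ))) * mass μ ^ (I.card - 1) ≤
      ∏ i ∈ I, ex μ (fun S => Real.exp (t * if i ∈ S then (1 : ℝ) else 0)) := by
  have hdet : ∀ i : σ, DeterminedBy (fun S : Finset σ => Real.exp (t * if i ∈ S then (1 : ℝ) else 0)) {i} :=
    fun i S T hST => by simp only [mem_iff_of_inter_singleton_eq hST]
  have hnn : ∀ (i : σ) (S : Finset σ), 0 ≤ Real.exp (t * if i ∈ S then (1 : ℝ) else 0) := fun i S =>
    (Real.exp_pos _).le
  rcases le_total 0 t with ht | ht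
  · have hmono : ∀ i : σ, Monotone fun S : Finset σ => Real.exp (t * if i ∈ S then (1 : ℝ) else 0) := by
      intro i
      have h := monotone_of_mem (σ := σ) i (a := Real.exp t) (b := 1) (Real.one_le_exp ht)
      simp only [← exp_mul_mem_indicator_eq] at h
      exact h
    have key := hμ.ex_prod_mul_pow_le h0 hmono hnn hdet hI
    simp only [prod_exp_mem_indicator] at key
    exact key
  · have hanti : ∀ i : σ, Antitone fun S : Finset σ => Real.exp (t * if i ∈ S then (1 : ℝ) else 0) := by
      intro i
      have h := antitone_of_mem (σ := σ) i (a := Real.exp t) (b := 1) (Real.exp_le_one_iff.2 ht)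
      simp only [← exp_mul_mem_indicator_eq] at h
      exact h
    have key := hμ.ex_prod_mul_pow_le_of_antitone h0 hanti hnn hdet hI
    simp only [prod_exp_mem_indicator] at key
    exact key

/-- **Proposition 5 for a probability weight**, verbatim: `E[e^{tX}] ≤ ∏_i E[e^{tX_i}]` for
`X = Σ_{i∈I} X_i`, every real `t`. [cite: DubhashiRanjan1998, §2.1 Prop. 5] -/
theorem DubhashiRanjan_prop_5 {μ : Finset σ → ℝ} (hμ : IsNegAssoc μ) (h0 : ∀ S, 0 ≤ μ S) (h1 : mass μ = 1)
    (t : ℝ) (I : Finset σ) :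
    ex μ (fun S => Real.exp (t * ((S ∩ I).card : ℝ))) ≤
      ∏ i ∈ I, ex μ (fun S => Real.exp (t * if i ∈ S then (1 : ℝ) else 0)) := by
  rcases I.eq_empty_or_nonempty with hI | hI
  · rw [hI, Finset.prod_empty]
    simp only [Finset.inter_empty, Finset.card_empty, Nat.cast_zero, mul_zero, Real.exp_zero]
    have hone : ex μ (fun _ => (1 : ℝ)) = mass μ := by
      rw [ex_def, mass_def]
      exact Finset.sum_congr rfl fun S _ => mul_one _
    rw [hone, h1]
  · have key := hμ.ex_exp_card_mul_pow_le h0 t hI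
    rwa [h1, one_pow, mul_one] at key

end Prop5


/-! ## §4 Block sums: thresholds of partial sums over disjoint blocks (Prop. 7 (2) with Prop. 3 (−OD)) -/

section BlockSums

variable {κ : Type u} [Fintype κ] [DecidableEq κ]

/-- **The event `{Σ_{i ∈ I_j} X_i ≥ t}`** of the `j`-th block sum. [cite: DubhashiRanjan1998, §2.1 Prop. 7 (2)
("`Y_j := h_j(X_i, i ∈ I_j)`" with `h_j = 𝟏[Σ x_i ≥ t]` non-decreasing), §3.1 Remark 15] -/
def blockSumGe (I : κ → Finset σ) (j : κ) (t : ℕ) : Finset (Finset σ) :=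
  Finset.univ.filter fun S => t ≤ (S ∩ I j).card

omit [Fintype κ] [DecidableEq κ] in
/-- Membership in `blockSumGe`. [cite: DubhashiRanjan1998, §2.1 Prop. 7 (2)] -/
theorem mem_blockSumGe {I : κ → Finset σ} {j : κ} {t : ℕ} {S : Finset σ} :
    S ∈ blockSumGe I j t ↔ t ≤ (S ∩ I j).card := by
  rw [blockSumGe, Finset.mem_filter, and_iff_right (Finset.mem_univ _)]

omit [Fintype κ] [DecidableEq κ] in
/-- `{Σ_{I_j} X_i ≥ t}` is increasing. [cite: DubhashiRanjan1998, §2.1 Prop. 7 (2) (non-decreasing `h_j`)] -/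
theorem isUpperSet_blockSumGe (I : κ → Finset σ) (j : κ) (t : ℕ) :
    IsUpperSet (blockSumGe I j t : Set (Finset σ)) := fun S T hST hS => by
  rw [Finset.mem_coe, mem_blockSumGe] at hS ⊢
  exact hS.trans (Finset.card_le_card (Finset.inter_subset_inter hST subset_rfl))

omit [Fintype κ] [DecidableEq κ] in
/-- `{Σ_{I_j} X_i ≥ t}` depends only on the block `I_j`. [cite: DubhashiRanjan1998, §2.1 Prop. 7 (2)
("functions of disjoint subsets")] -/
theorem determinedBy_blockSumGe (I : κ → Finset σ) (j : κ) (t : ℕ) :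
    DeterminedBy (setInd (blockSumGe I j t)) (I j) := fun S T hST => by
  rw [setInd_apply, setInd_apply]
  exact if_congr (by rw [mem_blockSumGe, mem_blockSumGe, hST]) rfl rfl

/-- **Thresholds of block sums of an NA family are NA** (Prop. 7 (2) with the non-decreasing
`h_j = 𝟏[Σ_{i∈I_j} x_i ≥ t_j]` on pairwise disjoint blocks `I_j`). [cite: DubhashiRanjan1998, §2.1
Prop. 7 (2); §3.1 Thm. 13 (proof pattern)] -/
theorem IsNegAssoc.blockSumGe {μ : Finset σ → ℝ} (hμ : IsNegAssoc μ) (I : κ → Finset σ)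
    (hdisj : ∀ j l, j ≠ l → Disjoint (I j) (I l)) (t : κ → ℕ) :
    IsNegAssoc (Literature.Probability.NegativeDependence.eventImage
      (fun j => Literature.Probability.NegativeDependence.blockSumGe I j (t j)) μ) :=
  hμ.eventImage (fun j => isUpperSet_blockSumGe I j (t j)) (fun j => determinedBy_blockSumGe I j (t j)) hdisj

omit [DecidableEq σ] in
/-- Expectation of a `0/1` function is the mass of the event. [cite: DubhashiRanjan1998, §2.1 Prop. 3 (proof:
indicator functions of events)] -/
theorem ex_ite_eq_sum_filter (μ : Finset σ → ℝ) (P : Finset σ → Prop) [DecidablePred P] :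
    ex μ (fun S => if P S then (1 : ℝ) else 0) = ∑ S ∈ Finset.univ.filter P, μ S := by
  rw [ex_def, Finset.sum_filter]
  exact Finset.sum_congr rfl fun S _ => by split_ifs <;> simp

/-- **Negative orthant dependence (−OD) of the block sums** (Prop. 3 (−OD) for the NA vector of Prop. 7 (2) /
Thm. 13, Remark 15: `Pr[B_i ≥ t_i, i ∈ I | B_j ≥ t_j, j ∈ J] ≤ Pr[B_i ≥ t_i, i ∈ I]`), unnormalized: for
disjoint `J₁, J₂`,
`μ(∀ j ∈ J₁ ∪ J₂, Σ_{I_j} X ≥ t_j) · μ(Ω) ≤ μ(∀ j ∈ J₁, Σ_{I_j} X ≥ t_j) · μ(∀ j ∈ J₂, Σ_{I_j} X ≥ t_j)`.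
[cite: DubhashiRanjan1998, §2.1 Prop. 3 (−OD), Prop. 7 (2); §3.1 Remark 15] -/
theorem IsNegAssoc.blockSum_orthant {μ : Finset σ → ℝ} (hμ : IsNegAssoc μ) (I : κ → Finset σ)
    (hdisj : ∀ j l, j ≠ l → Disjoint (I j) (I l)) (t : κ → ℕ) {J₁ J₂ : Finset κ} (hJ : Disjoint J₁ J₂) :
    (∑ S ∈ Finset.univ.filter (fun S => ∀ j ∈ J₁ ∪ J₂, t j ≤ (S ∩ I j).card), μ S) * mass μ ≤
      (∑ S ∈ Finset.univ.filter (fun S => ∀ j ∈ J₁, t j ≤ (S ∩ I j).card), μ S) *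
        ∑ S ∈ Finset.univ.filter (fun S => ∀ j ∈ J₂, t j ≤ (S ∩ I j).card), μ S := by
  have key := (hμ.blockSumGe I hdisj t).supset_union_mul_mass_le hJ
  rw [ex_eventImage, ex_eventImage, ex_eventImage, mass_eventImage] at key
  -- `J ⊆ {j : S ∈ 𝒜_j}` iff `∀ j ∈ J, Σ_{I_j} X(S) ≥ t_j`
  have hsub : ∀ (J : Finset κ) (S : Finset σ),
      J ⊆ Finset.univ.filter (fun j => S ∈ Literature.Probability.NegativeDependence.blockSumGe I j (t j)) ↔
        ∀ j ∈ J, t j ≤ (S ∩ I j).card := by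
    intro J S
    simp only [Finset.subset_iff, Finset.mem_filter, Finset.mem_univ, true_and, mem_blockSumGe]
  simp only [hsub] at key
  rwa [ex_ite_eq_sum_filter, ex_ite_eq_sum_filter, ex_ite_eq_sum_filter] at key

end BlockSums

end Literature.Probability.NegativeDependence

end
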